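import Literature.MathematicalPhysics.QuantumFieldTheory.Balaban1983to89.B9Eq349ConjugatedQTowerLettersTwoBackgrounds

/-!
# `Balaban1983to89.B9Eq349ConjugatedQTowerLettersTwoBackgroundsReadings` — T. Bałaban, *Propagators for lattice gauge theories in a background field*,
# Commun. Math. Phys. **99** (1985) 389–434 [Balaban1985BackgroundPropagators] (3.15)–(3.16) p. 393, (3.26) p. 395, (3.49) p. 399, (3.101)–(3.103) p. 414:
# **THE CONJUGATED TWO-BACKGROUND TOWER `Q_k` LETTERS `δ_Q` ∕ `δ_Q′` ON THE CHAIN's WEIGHTED `L²` CARRIERS** — for the tower averaging `Q_{n+1}(·) = QkW` of two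
# backgrounds `U`, `V` of the level-`(n+1)` torus and the weights `S⁻¹ = e^{−κχ_{n+1}}` (fine bonds), `S_F = e^{κχ_0}` (coarse bonds):
# `‖S_F(Q_{n+1}(U)(S⁻¹f)) − S_F(Q_{n+1}(V)(S⁻¹f))‖_{L²(c₁)} ≤ M_φ′M_φ·√(c₁∕(c₀L^{(n+1)d}))·P′_{n+1}·(T̃_{n+1} − 1)·‖f‖_{L²(c₀)}` and the adjoint reading
# `‖S(Q_{n+1}(U)†(S_F⁻¹g)) − S(Q_{n+1}(V)†(S_F⁻¹g))‖ ≤` the same `× ‖g‖`, `P′`, `T̃` the products of `B9Eq349ConjugatedQTowerLettersTwoBackgrounds`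

statement-level skeleton of published theorems with citation tags; proofs where landed; nothing here is a claim about the Yang–Mills mass gap

PDF held: `paper:balaban1985-cmp99-background-propagators` (journal page = PDF page + 388): p. 393 (3.15)–(3.16), p. 395 (3.26), p. 399 (3.49), p. 414
(3.101)–(3.103) — through the held text and the verbatim quotations of the suppliers.

CITATION HEADER (lean-in-tree rule 2026-08-18).  Audit cell `pub-balaban`, sub-cell `t4`, NE9 crux team (2): LEAF PROVER 01
(`b2b-balaban-t4-ne9-formalise-leaf-01` gen 90), file 3 of the batch «the `δ_Q` ∕ `δ_Q′` conjuncts of the N52 road (α) END» (this lineage's I-13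
`B9Eq326DeltaABlockDecayTowerTwoBackgroundsCurv`, gen 88: its `hT2'` displays `δ_R`, `δ_Q`, `δ_Q′`).  WHY: the raw `ℓ²` tower letter of the sibling
`B9Eq349ConjugatedQTowerLettersTwoBackgrounds.sqrt_sum_norm_sq_Qtower_conj_sub_Qtower_conj_le` (`𝔸`-valued bond functions, unweighted `ℓ²`) is read here
on the chain's carriers `BondL2K` (fibre `φ : W ≃ 𝔸` with `M_φ`, `M_φ′`; weights `c₀` fine, `c₁` coarse) for the tower operator `QkW` of
`B9Eq326OperatorTower`, exactly as the NE9 OWNER lineage gen 93 reads its one-family letter (`B9Eq349ConjugatedQTowerLetters.norm_conj_QkW_sub_le`, §3 —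
TEMPLATE CREDITED: the transport is theirs token for token); the adjoint reading passes through the pairing by ne9-leaf-04's
`B9Eq324ConjugatedFormDifference.norm_le_of_inner_eq_inner` and ne9-leaf-06's `B9Eq311PointwiseMultipliers.equiv_adjoint_of_pointwise`.  Per-level
cut-offs `χ_j` ∕ readings `ℓ′_j` stay DISPLAYED here; the companion shape (ONE physical cut-off pair, `exp(κ•M_B)` ∕ `exp(κ•M_F)`) = the literal `hT2'`
conjuncts is the sibling `B9Eq349ConjugatedQTowerLettersTwoBackgroundsCompanion`.

WHAT IS PROVED (sorry-free; proof lane — no `def`; [folklore] Hilbert-space plumbing BY NAME; nothing of [B9]∕[B7] asserted).  Data: the sibling's at height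
`k = n+1` (two backgrounds `U`, `V` of `T_{L^{n+1}m}` with `α_j` ∕ `α′_j ≤ 1∕128`, common `ε_j`, multiplicative closeness `δ_j ≤ 1∕(12288N)`, cut-offs `χ_j`,
readings `ℓ′_j`, windows `‖κ‖ℓ′_j ≤ 1`), fibre `φ`, weights `c₀`, `c₁`, multipliers `S⁻¹`, `S_F` (resp. `S`, `S_F⁻¹`) given by their pointwise action.
* **`norm_conj_QkW_sub_conj_QkW_le`** (the `δ_Q` letter displayed in the title), `norm_conj_QkW_sub_conj_QkW_le_negConj` (the same at `−κ̄` through the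
  adjoints' pointwise action), **`norm_conj_adjoint_QkW_sub_conj_adjoint_QkW_le`** (the `δ_Q′` letter).
MODEL ∕ DECLARED READINGS.  Those of the sibling and of `B9Eq326OperatorTower` (the tower of tori, `UlevOf`, `QkW`; `𝔸` complete normed `ℂ`-algebra with
`‖1‖ = 1`, `W` a finite-dimensional Hilbert fibre for the adjoint readings); every regularity ∕ smallness ∕ closeness letter DISPLAYED.
HONEST SCOPE.  [folklore] composition; crude constants; along (3.16) `√(c₁∕(c₀L^{(n+1)d})) = 1` (the reader's); nothing of [B9] Thm 3.1∕3.3∕3.11 or [B7]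
Prop. 2∕7 asserted, valued or discharged; «NE9 ⇐ the named binders»; NE9 NOT PRINTED ∕ NOT PROVED; NOT summit progress (cell pub-balaban: row NE9 WALLED ON
A MODEL (O-NE9-1; #5 UNRULED); spine PROVED 0∕9; rung (B)+1 on a finite T⁴ — NOT infinite volume, NOT mass gap, NOT BetaPertH, NOT Clay; HONEST DEPENDENCY:
continuum YM on T⁴ ⇐ BetaPertH ∧ nine spine estimates (0/9 proved); BetaPertH ⇐ (D1) ∧ (D4) ∧ CAP+tail; G-an2-4 gates asym, D1 and NE2/3/4).  NEW file;
nothing modified.  Net new unproved facts: 0.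
-/

noncomputable section

open scoped InnerProductSpace ComplexConjugate BigOperators

namespace Literature.MathematicalPhysics.QuantumFieldTheory.Balaban1983to89.B9Eq349ConjugatedQTowerLettersTwoBackgroundsReadings

open B4Sect5Torus (TSite)
open B9SectCLatticeCarrier (Bond shift)
open B7Prop1Explicit (U1 Wcx boxVec)
open B9Eq319QprimeTorus (fineP blockCoord)
open B9Eq315QTorus (perCfg cornerSite)
open B9Eq315QTower (towerP UlevOf Qtower QkOfU)
open B9Eq326OperatorTower (QkW)
open B9Eq311L2Pairing (WL2)
open B11Eq103H1Complex (BondL2K)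
open B9Eq349ConjugatedQTowerLettersTwoBackgrounds (sqrt_sum_norm_sq_Qtower_conj_sub_Qtower_conj_le)

variable {d : ℕ} (L : ℕ) [NeZero L]

omit [NeZero L] in
/-- `(√a)^n = √(a^n)` for `a ≥ 0`. [folklore] -/
private theorem sqrt_pow_eq {a : ℝ} (ha : 0 ≤ a) : ∀ n : ℕ, (Real.sqrt a) ^ n = Real.sqrt (a ^ n)
  | 0 => by simp
  | n + 1 => by rw [pow_succ, sqrt_pow_eq ha n, pow_succ, Real.sqrt_mul (pow_nonneg ha n)]

section Readings

variable {𝔸 : Type*} [NormedRing 𝔸] [NormOneClass 𝔸] [NormedAlgebra ℂ 𝔸] [CompleteSpace 𝔸]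
  (m : Fin d → ℕ) [∀ i, NeZero (m i)] (n : ℕ) (hL : 1 ≤ L)
  {W : Type*} [NormedAddCommGroup W] [InnerProductSpace ℂ W] (φ : W ≃ₗ[ℂ] 𝔸) {Mφ Mφ' : ℝ} (hMφ : 0 ≤ Mφ) (hMφ' : 0 ≤ Mφ')
  (hφ : ∀ w, ‖φ w‖ ≤ Mφ * ‖w‖) (hφ' : ∀ X, ‖φ.symm X‖ ≤ Mφ' * ‖X‖) {c₀ c₁ : ℝ} [Fact (0 < c₀)] [Fact (0 < c₁)]
  (U V : Bond d (towerP L m (n + 1)) → 𝔸ˣ) (α : ℕ → ℝ) (hα1 : ∀ j, α j ≤ 1 / 64)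
  (hU1 : ∀ (j : ℕ) (x : B7Prop1Explicit.Site d) (κ : Fin d), perCfg (towerP L m (j + 1)) (UlevOf L m (n + 1) U j) x κ ∈ U1 𝔸)
  (hreg : ∀ (j : ℕ) (y : TSite d (towerP L m j)) (κ : Fin d) (r : Fin d → Fin L),
    ‖((Wcx L (perCfg (towerP L m (j + 1)) (UlevOf L m (n + 1) U j)) (cornerSite L y) κ (boxVec L r) : 𝔸ˣ) : 𝔸) - 1‖ ≤ α j)
  (α' : ℕ → ℝ) (hα1' : ∀ j, α' j ≤ 1 / 64)
  (hV1 : ∀ (j : ℕ) (x : B7Prop1Explicit.Site d) (κ : Fin d), perCfg (towerP L m (j + 1)) (UlevOf L m (n + 1) V j) x κ ∈ U1 𝔸)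
  (hregV : ∀ (j : ℕ) (y : TSite d (towerP L m j)) (κ : Fin d) (r : Fin d → Fin L),
    ‖((Wcx L (perCfg (towerP L m (j + 1)) (UlevOf L m (n + 1) V j)) (cornerSite L y) κ (boxVec L r) : 𝔸ˣ) : 𝔸) - 1‖ ≤ α' j)
  (hα128 : ∀ j, α' j ≤ 1 / 128)
  (εU : ℕ → ℝ) (hεU : ∀ j, 0 ≤ εU j)
  (hUε : ∀ (j : ℕ) (b : Bond d (towerP L m (j + 1))), ‖(UlevOf L m (n + 1) U j b : 𝔸) - 1‖ ≤ εU j)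
  (hVε : ∀ (j : ℕ) (b : Bond d (towerP L m (j + 1))), ‖(UlevOf L m (n + 1) V j b : 𝔸) - 1‖ ≤ εU j)
  (δUV : ℕ → ℝ) (hδUV : ∀ j, 0 ≤ δUV j) (hδmax : ∀ j, δUV j ≤ 1 / (12288 * ((2 * (d * L) + L + L : ℕ) : ℝ)))
  (hUVδ : ∀ (j : ℕ) (b : Bond d (towerP L m (j + 1))),
    ‖(UlevOf L m (n + 1) U j b : 𝔸) * (((UlevOf L m (n + 1) V j b)⁻¹ : 𝔸ˣ) : 𝔸) - 1‖ ≤ δUV j)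
  {κc : ℂ} (χ : (j : ℕ) → TSite d (towerP L m j) → ℝ) (ℓ' : ℕ → ℝ) (hℓ' : ∀ j, 0 ≤ ℓ' j)
  (hχ : ∀ j, j < n + 1 → ∀ (c : Bond d (towerP L m j)) (b : Bond d (towerP L m (j + 1))),
    (blockCoord L (towerP L m j) b.1 = c.1 ∨ blockCoord L (towerP L m j) b.1 = shift c.2 c.1) → |χ j c.1 - χ (j + 1) b.1| ≤ ℓ' j)
  (hwin : ∀ j, j < n + 1 → ‖κc‖ * ℓ' j ≤ 1)
  {Sinv : BondL2K ℂ d (towerP L m (n + 1)) c₀ W →ₗ[ℂ] BondL2K ℂ d (towerP L m (n + 1)) c₀ W}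
  (hSinv : ∀ (f : BondL2K ℂ d (towerP L m (n + 1)) c₀ W) (b : Bond d (towerP L m (n + 1))),
    WL2.equiv ℂ (fun _ : Bond d (towerP L m (n + 1)) => c₀) W (Sinv f) b =
      Complex.exp (-(κc * (χ (n + 1) b.1 : ℂ))) • WL2.equiv ℂ (fun _ : Bond d (towerP L m (n + 1)) => c₀) W f b)
  {SF : BondL2K ℂ d m c₁ W →ₗ[ℂ] BondL2K ℂ d m c₁ W}
  (hSF : ∀ (g : BondL2K ℂ d m c₁ W) (c : Bond d m),
    WL2.equiv ℂ (fun _ : Bond d m => c₁) W (SF g) c = Complex.exp (κc * (χ 0 c.1 : ℂ)) • WL2.equiv ℂ (fun _ : Bond d m => c₁) W g c)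

include hεU hδUV hℓ' in
omit [NeZero L] in
/-- The constant `P′_{n+1}·(T̃_{n+1} − 1)` is nonnegative (`1 ≤ T̃`). [folklore] -/
private theorem prod_mul_prod_sub_one_nonneg :
    0 ≤ (∏ j ∈ Finset.range (n + 1), (1 + Real.sqrt ((L : ℝ) ^ d) * (Real.sqrt (2 * d) * (102 * (d + 1) ^ 2 * L * εU j) +
          2 * (‖κc‖ * ℓ' j) * Real.sqrt (2 * (2 * d * (102 * (d + 1) ^ 2 * L * εU j) ^ 2 + ((L : ℝ) ^ d)⁻¹))))) *
        ((∏ j ∈ Finset.range (n + 1), (1 + Real.sqrt ((L : ℝ) ^ d) *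
            ((1 + 2 * (‖κc‖ * ℓ' j)) * (2 * d) * (75497472 * ((d : ℝ) + 1) * ((2 * (d * L) + L + L : ℕ) : ℝ) * δUV j)))) - 1) := by
  refine mul_nonneg (Finset.prod_nonneg fun j _ => by have := hεU j; have := hℓ' j; positivity)
    (sub_nonneg.2 (Finset.one_le_prod (s := Finset.range (n + 1)) fun j _ => ?_))
  have := hℓ' j; have := hδUV j
  have h0 : 0 ≤ Real.sqrt ((L : ℝ) ^ d) *
      ((1 + 2 * (‖κc‖ * ℓ' j)) * (2 * d) * (75497472 * ((d : ℝ) + 1) * ((2 * (d * L) + L + L : ℕ) : ℝ) * δUV j)) := by positivity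
  linarith

include hφ hφ' hMφ hMφ' hα128 hεU hUε hVε hδUV hδmax hUVδ hℓ' hχ hwin hSinv hSF in
/-- **THE `δ_Q` LETTER AT THE TOWER, ON THE CHAIN's CARRIERS**: `‖S_F(Q_{n+1}(U)(S⁻¹f)) − S_F(Q_{n+1}(V)(S⁻¹f))‖_{L²(c₁)} ≤ M_φ′M_φ·√(c₁∕(c₀L^{(n+1)d}))·
P′_{n+1}(T̃_{n+1} − 1)·‖f‖_{L²(c₀)}` — the sibling's raw letter at the `𝔸`-valued `Φf`, read through `φ⁻¹` and the two weights exactly as gen 93's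
`norm_conj_QkW_sub_le`; along (3.16) `√(c₁∕(c₀L^{kd})) = 1`. [cite: Balaban1985BackgroundPropagators, (3.15)–(3.16) p.393, (3.49) p.399, (3.101) p.414] -/
theorem norm_conj_QkW_sub_conj_QkW_le (f : BondL2K ℂ d (towerP L m (n + 1)) c₀ W) :
    ‖SF (QkW L m n φ U hL α hα1 hU1 hreg (c₀ := c₀) (c₁ := c₁) (Sinv f)) - SF (QkW L m n φ V hL α' hα1' hV1 hregV (c₀ := c₀) (c₁ := c₁) (Sinv f))‖ ≤
      Mφ' * Mφ * Real.sqrt (c₁ / (c₀ * ((L : ℝ) ^ (n + 1)) ^ d)) *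
        ((∏ j ∈ Finset.range (n + 1), (1 + Real.sqrt ((L : ℝ) ^ d) * (Real.sqrt (2 * d) * (102 * (d + 1) ^ 2 * L * εU j) +
            2 * (‖κc‖ * ℓ' j) * Real.sqrt (2 * (2 * d * (102 * (d + 1) ^ 2 * L * εU j) ^ 2 + ((L : ℝ) ^ d)⁻¹))))) *
          ((∏ j ∈ Finset.range (n + 1), (1 + Real.sqrt ((L : ℝ) ^ d) *
              ((1 + 2 * (‖κc‖ * ℓ' j)) * (2 * d) * (75497472 * ((d : ℝ) + 1) * ((2 * (d * L) + L + L : ℕ) : ℝ) * δUV j)))) - 1)) * ‖f‖ := by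
  have hc₀ : 0 < c₀ := Fact.out
  have hc₁ : 0 < c₁ := Fact.out
  have hL0 : (0 : ℝ) < L := by exact_mod_cast hL
  set g : Bond d (towerP L m (n + 1)) → 𝔸 := fun b => φ (WL2.equiv ℂ (fun _ : Bond d (towerP L m (n + 1)) => c₀) W f b) with hg
  set P : ℝ := (∏ j ∈ Finset.range (n + 1), (1 + Real.sqrt ((L : ℝ) ^ d) * (Real.sqrt (2 * d) * (102 * (d + 1) ^ 2 * L * εU j) +
      2 * (‖κc‖ * ℓ' j) * Real.sqrt (2 * (2 * d * (102 * (d + 1) ^ 2 * L * εU j) ^ 2 + ((L : ℝ) ^ d)⁻¹))))) *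
    ((∏ j ∈ Finset.range (n + 1), (1 + Real.sqrt ((L : ℝ) ^ d) *
        ((1 + 2 * (‖κc‖ * ℓ' j)) * (2 * d) * (75497472 * ((d : ℝ) + 1) * ((2 * (d * L) + L + L : ℕ) : ℝ) * δUV j)))) - 1) with hP
  have hP0 : 0 ≤ P := prod_mul_prod_sub_one_nonneg L n εU hεU δUV hδUV ℓ' hℓ' (κc := κc)
  -- the fine side: `√(Σ_b ‖g b‖²) ≤ M_φ·‖f‖∕√c₀`
  have hn : ‖f‖ ^ 2 = ∑ b, c₀ * ‖WL2.equiv ℂ (fun _ : Bond d (towerP L m (n + 1)) => c₀) W f b‖ ^ 2 :=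
    WL2.norm_sq (𝕜 := ℂ) (w := fun _ : Bond d (towerP L m (n + 1)) => c₀) (V := W) f
  have hfine : ∑ b, ‖g b‖ ^ 2 ≤ Mφ ^ 2 * (c₀⁻¹ * ‖f‖ ^ 2) := by
    rw [hn, Finset.mul_sum, Finset.mul_sum]
    refine Finset.sum_le_sum fun b _ => ?_
    have h1 : ‖g b‖ ^ 2 ≤ (Mφ * ‖WL2.equiv ℂ (fun _ : Bond d (towerP L m (n + 1)) => c₀) W f b‖) ^ 2 :=
      pow_le_pow_left₀ (norm_nonneg _) (hφ _) 2
    refine h1.trans (le_of_eq ?_)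
    field_simp
  have hfine' : Real.sqrt (∑ b, ‖g b‖ ^ 2) ≤ Mφ * (‖f‖ / Real.sqrt c₀) := by
    calc Real.sqrt (∑ b, ‖g b‖ ^ 2) ≤ Real.sqrt (Mφ ^ 2 * (c₀⁻¹ * ‖f‖ ^ 2)) := Real.sqrt_le_sqrt hfine
      _ = Mφ * (‖f‖ / Real.sqrt c₀) := by
          rw [Real.sqrt_mul' _ (by positivity), Real.sqrt_sq hMφ, Real.sqrt_mul' _ (by positivity), Real.sqrt_sq (norm_nonneg _),
            Real.sqrt_inv, div_eq_inv_mul]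
  -- the raw tower letter at `g`
  have htel := sqrt_sum_norm_sq_Qtower_conj_sub_Qtower_conj_le L m hL (n + 1) U V α hα1 hU1 hreg α' hα1' hV1 hregV hα128 εU hεU hUε hVε
    δUV hδUV hδmax hUVδ χ ℓ' hℓ' hχ hwin (n + 1) le_rfl g
  -- the coarse side, pointwise through `φ⁻¹`
  have hS' : (fun b => φ (WL2.equiv ℂ (fun _ : Bond d (towerP L m (n + 1)) => c₀) W (Sinv f) b)) =
      fun b => Complex.exp (-(κc * (χ (n + 1) b.1 : ℂ))) • g b := funext fun b => by rw [hSinv, LinearEquiv.map_smul]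
  have hval : ∀ c : Bond d m, ‖WL2.equiv ℂ (fun _ : Bond d m => c₁) W
        (SF (QkW L m n φ U hL α hα1 hU1 hreg (c₀ := c₀) (c₁ := c₁) (Sinv f)) - SF (QkW L m n φ V hL α' hα1' hV1 hregV (c₀ := c₀) (c₁ := c₁) (Sinv f))) c‖ ^ 2 ≤
      Mφ' ^ 2 * ‖Complex.exp (κc * (χ 0 c.1 : ℂ)) •
          QkOfU L m hL (n + 1) U α hα1 hU1 hreg (fun b => Complex.exp (-(κc * (χ (n + 1) b.1 : ℂ))) • g b) c -
        Complex.exp (κc * (χ 0 c.1 : ℂ)) •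
          QkOfU L m hL (n + 1) V α' hα1' hV1 hregV (fun b => Complex.exp (-(κc * (χ (n + 1) b.1 : ℂ))) • g b) c‖ ^ 2 := by
    intro c
    rw [WL2.equiv_sub, Pi.sub_apply, hSF, hSF]
    show ‖Complex.exp (κc * (χ 0 c.1 : ℂ)) • φ.symm (QkOfU L m hL (n + 1) U α hα1 hU1 hreg
        (fun b => φ (WL2.equiv ℂ (fun _ : Bond d (towerP L m (n + 1)) => c₀) W (Sinv f) b)) c) -
        Complex.exp (κc * (χ 0 c.1 : ℂ)) • φ.symm (QkOfU L m hL (n + 1) V α' hα1' hV1 hregV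
        (fun b => φ (WL2.equiv ℂ (fun _ : Bond d (towerP L m (n + 1)) => c₀) W (Sinv f) b)) c)‖ ^ 2 ≤ _
    rw [hS', ← LinearEquiv.map_smul, ← LinearEquiv.map_smul, ← map_sub, ← mul_pow]
    exact pow_le_pow_left₀ (norm_nonneg _) (hφ' _) 2
  have hsq : ‖SF (QkW L m n φ U hL α hα1 hU1 hreg (c₀ := c₀) (c₁ := c₁) (Sinv f)) - SF (QkW L m n φ V hL α' hα1' hV1 hregV (c₀ := c₀) (c₁ := c₁) (Sinv f))‖ ^ 2 ≤
      c₁ * Mφ' ^ 2 * ∑ c, ‖Complex.exp (κc * (χ 0 c.1 : ℂ)) •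
          QkOfU L m hL (n + 1) U α hα1 hU1 hreg (fun b => Complex.exp (-(κc * (χ (n + 1) b.1 : ℂ))) • g b) c -
        Complex.exp (κc * (χ 0 c.1 : ℂ)) •
          QkOfU L m hL (n + 1) V α' hα1' hV1 hregV (fun b => Complex.exp (-(κc * (χ (n + 1) b.1 : ℂ))) • g b) c‖ ^ 2 := by
    rw [WL2.norm_sq (𝕜 := ℂ) (w := fun _ : Bond d m => c₁) (V := W), Finset.mul_sum]
    exact Finset.sum_le_sum fun c _ => by
      have := mul_le_mul_of_nonneg_left (hval c) hc₁.le
      linarith [this]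
  have hroot : ‖SF (QkW L m n φ U hL α hα1 hU1 hreg (c₀ := c₀) (c₁ := c₁) (Sinv f)) - SF (QkW L m n φ V hL α' hα1' hV1 hregV (c₀ := c₀) (c₁ := c₁) (Sinv f))‖ ≤
      Real.sqrt c₁ * Mφ' * Real.sqrt (∑ c, ‖Complex.exp (κc * (χ 0 c.1 : ℂ)) •
          QkOfU L m hL (n + 1) U α hα1 hU1 hreg (fun b => Complex.exp (-(κc * (χ (n + 1) b.1 : ℂ))) • g b) c -
        Complex.exp (κc * (χ 0 c.1 : ℂ)) •
          QkOfU L m hL (n + 1) V α' hα1' hV1 hregV (fun b => Complex.exp (-(κc * (χ (n + 1) b.1 : ℂ))) • g b) c‖ ^ 2) := by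
    have h := Real.sqrt_le_sqrt hsq
    rw [Real.sqrt_sq (norm_nonneg _), Real.sqrt_mul' _ (Finset.sum_nonneg fun _ _ => by positivity), Real.sqrt_mul' _ (by positivity),
      Real.sqrt_sq hMφ'] at h
    exact h
  refine hroot.trans ?_
  have hQk : ∑ c, ‖Complex.exp (κc * (χ 0 c.1 : ℂ)) •
          QkOfU L m hL (n + 1) U α hα1 hU1 hreg (fun b => Complex.exp (-(κc * (χ (n + 1) b.1 : ℂ))) • g b) c -
        Complex.exp (κc * (χ 0 c.1 : ℂ)) •
          QkOfU L m hL (n + 1) V α' hα1' hV1 hregV (fun b => Complex.exp (-(κc * (χ (n + 1) b.1 : ℂ))) • g b) c‖ ^ 2 =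
      ∑ c : Bond d m, ‖Complex.exp (κc * (χ 0 c.1 : ℂ)) •
          Qtower L m hL (UlevOf L m (n + 1) U) α hα1 hU1 hreg (n + 1) (fun b => Complex.exp (-(κc * (χ (n + 1) b.1 : ℂ))) • g b) c -
        Complex.exp (κc * (χ 0 c.1 : ℂ)) •
          Qtower L m hL (UlevOf L m (n + 1) V) α' hα1' hV1 hregV (n + 1) (fun b => Complex.exp (-(κc * (χ (n + 1) b.1 : ℂ))) • g b) c‖ ^ 2 := rfl
  rw [hQk]
  calc Real.sqrt c₁ * Mφ' * Real.sqrt (∑ c : Bond d m, ‖Complex.exp (κc * (χ 0 c.1 : ℂ)) •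
          Qtower L m hL (UlevOf L m (n + 1) U) α hα1 hU1 hreg (n + 1) (fun b => Complex.exp (-(κc * (χ (n + 1) b.1 : ℂ))) • g b) c -
          Complex.exp (κc * (χ 0 c.1 : ℂ)) •
          Qtower L m hL (UlevOf L m (n + 1) V) α' hα1' hV1 hregV (n + 1) (fun b => Complex.exp (-(κc * (χ (n + 1) b.1 : ℂ))) • g b) c‖ ^ 2)
      ≤ Real.sqrt c₁ * Mφ' * (P * ((Real.sqrt (((L : ℝ) ^ d)⁻¹)) ^ (n + 1) * Real.sqrt (∑ b, ‖g b‖ ^ 2))) :=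
        mul_le_mul_of_nonneg_left htel (by positivity)
    _ ≤ Real.sqrt c₁ * Mφ' * (P * ((Real.sqrt (((L : ℝ) ^ d)⁻¹)) ^ (n + 1) * (Mφ * (‖f‖ / Real.sqrt c₀)))) :=
        mul_le_mul_of_nonneg_left (mul_le_mul_of_nonneg_left (mul_le_mul_of_nonneg_left hfine' (by positivity)) hP0) (by positivity)
    _ = Mφ' * Mφ * Real.sqrt (c₁ / (c₀ * ((L : ℝ) ^ (n + 1)) ^ d)) * P * ‖f‖ := by
        have hρ : (Real.sqrt (((L : ℝ) ^ d)⁻¹)) ^ (n + 1) = Real.sqrt ((((L : ℝ) ^ (n + 1)) ^ d)⁻¹) := by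
          rw [sqrt_pow_eq (by positivity : (0:ℝ) ≤ ((L : ℝ) ^ d)⁻¹) (n + 1)]
          congr 1
          rw [inv_pow, ← pow_mul, ← pow_mul, Nat.mul_comm d (n + 1)]
        have hsplit : Real.sqrt (c₁ / (c₀ * ((L : ℝ) ^ (n + 1)) ^ d)) = Real.sqrt c₁ * (Real.sqrt ((((L : ℝ) ^ (n + 1)) ^ d)⁻¹) * (Real.sqrt c₀)⁻¹) := by
          rw [div_eq_mul_inv, mul_inv, Real.sqrt_mul hc₁.le, Real.sqrt_mul (inv_nonneg.2 hc₀.le), Real.sqrt_inv c₀]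
          ring
        rw [hρ, hsplit, div_eq_mul_inv]
        ring

variable {S : BondL2K ℂ d (towerP L m (n + 1)) c₀ W →ₗ[ℂ] BondL2K ℂ d (towerP L m (n + 1)) c₀ W}
  (hS : ∀ (f : BondL2K ℂ d (towerP L m (n + 1)) c₀ W) (b : Bond d (towerP L m (n + 1))),
    WL2.equiv ℂ (fun _ : Bond d (towerP L m (n + 1)) => c₀) W (S f) b =
      Complex.exp (κc * (χ (n + 1) b.1 : ℂ)) • WL2.equiv ℂ (fun _ : Bond d (towerP L m (n + 1)) => c₀) W f b)
  {SFinv : BondL2K ℂ d m c₁ W →ₗ[ℂ] BondL2K ℂ d m c₁ W}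
  (hSFinv : ∀ (g : BondL2K ℂ d m c₁ W) (c : Bond d m),
    WL2.equiv ℂ (fun _ : Bond d m => c₁) W (SFinv g) c = Complex.exp (-(κc * (χ 0 c.1 : ℂ))) • WL2.equiv ℂ (fun _ : Bond d m => c₁) W g c)

include hφ hφ' hMφ hMφ' hα128 hεU hUε hVε hδUV hδmax hUVδ hℓ' hχ hwin hS hSFinv in
/-- **… AT `−κ̄` THROUGH THE ADJOINTS' POINTWISE ACTION** (`S† = e^{κ̄χ_{n+1}}`, `(S_F⁻¹)† = e^{−κ̄χ_0}`, `B9Eq311PointwiseMultipliers.equiv_adjoint_of_pointwise`):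
`‖(S_F⁻¹)†(Q_{n+1}(U)(S†f)) − (S_F⁻¹)†(Q_{n+1}(V)(S†f))‖ ≤` the same constant `× ‖f‖` (it depends on `κ` through `‖κ‖ = ‖−κ̄‖` only). [folklore]
[cite: Balaban1985BackgroundPropagators, (3.15) p.393, (3.49) p.399, (3.101) p.414] -/
theorem norm_conj_QkW_sub_conj_QkW_le_negConj [FiniteDimensional ℂ W] (f : BondL2K ℂ d (towerP L m (n + 1)) c₀ W) :
    ‖LinearMap.adjoint SFinv (QkW L m n φ U hL α hα1 hU1 hreg (c₀ := c₀) (c₁ := c₁) (LinearMap.adjoint S f)) -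
        LinearMap.adjoint SFinv (QkW L m n φ V hL α' hα1' hV1 hregV (c₀ := c₀) (c₁ := c₁) (LinearMap.adjoint S f))‖ ≤
      Mφ' * Mφ * Real.sqrt (c₁ / (c₀ * ((L : ℝ) ^ (n + 1)) ^ d)) *
        ((∏ j ∈ Finset.range (n + 1), (1 + Real.sqrt ((L : ℝ) ^ d) * (Real.sqrt (2 * d) * (102 * (d + 1) ^ 2 * L * εU j) +
            2 * (‖κc‖ * ℓ' j) * Real.sqrt (2 * (2 * d * (102 * (d + 1) ^ 2 * L * εU j) ^ 2 + ((L : ℝ) ^ d)⁻¹))))) *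
          ((∏ j ∈ Finset.range (n + 1), (1 + Real.sqrt ((L : ℝ) ^ d) *
              ((1 + 2 * (‖κc‖ * ℓ' j)) * (2 * d) * (75497472 * ((d : ℝ) + 1) * ((2 * (d * L) + L + L : ℕ) : ℝ) * δUV j)))) - 1)) * ‖f‖ := by
  have hA : ∀ (g : BondL2K ℂ d m c₁ W) (c : Bond d m),
      WL2.equiv ℂ (fun _ : Bond d m => c₁) W (LinearMap.adjoint SFinv g) c =
        Complex.exp (-conj κc * (χ 0 c.1 : ℂ)) • WL2.equiv ℂ (fun _ : Bond d m => c₁) W g c := by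
    intro g c
    rw [B9Eq311PointwiseMultipliers.equiv_adjoint_of_pointwise SFinv _ hSFinv, ← Complex.exp_conj, map_neg, map_mul, Complex.conj_ofReal,
      neg_mul]
  have hB : ∀ (f : BondL2K ℂ d (towerP L m (n + 1)) c₀ W) (b : Bond d (towerP L m (n + 1))),
      WL2.equiv ℂ (fun _ : Bond d (towerP L m (n + 1)) => c₀) W (LinearMap.adjoint S f) b =
        Complex.exp (-(-conj κc * (χ (n + 1) b.1 : ℂ))) • WL2.equiv ℂ (fun _ : Bond d (towerP L m (n + 1)) => c₀) W f b := by
    intro f b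
    rw [B9Eq311PointwiseMultipliers.equiv_adjoint_of_pointwise S _ hS, ← Complex.exp_conj, map_mul, Complex.conj_ofReal, neg_mul, neg_neg]
  have hwin1 : ∀ j, j < n + 1 → ‖-conj κc‖ * ℓ' j ≤ 1 := fun j hj => by rw [norm_neg, Complex.norm_conj]; exact hwin j hj
  have h := norm_conj_QkW_sub_conj_QkW_le L m n hL φ hMφ hMφ' hφ hφ' (c₀ := c₀) (c₁ := c₁) U V α hα1 hU1 hreg α' hα1' hV1 hregV hα128 εU hεU hUε hVε
    δUV hδUV hδmax hUVδ χ ℓ' hℓ' hχ hwin1 hB hA f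
  simpa only [norm_neg, Complex.norm_conj] using h

include hφ hφ' hMφ hMφ' hα128 hεU hUε hVε hδUV hδmax hUVδ hℓ' hχ hwin hS hSFinv in
/-- **THE ADJOINT READING `δ_Q′` AT THE TOWER: `‖S(Q_{n+1}(U)†(S_F⁻¹g)) − S(Q_{n+1}(V)†(S_F⁻¹g))‖ ≤` the same `× ‖g‖`** — a bound passes through the
pairing (`B9Eq324ConjugatedFormDifference.norm_le_of_inner_eq_inner` with `⟪S(Q_U† − Q_V†)(S_F⁻¹g), f⟫ = ⟪g, (S_F⁻¹)†(Q_U − Q_V)(S†f)⟫`). [folklore]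
[cite: Balaban1985BackgroundPropagators, (3.15)–(3.16) p.393, (3.26) p.395, (3.49) p.399] -/
theorem norm_conj_adjoint_QkW_sub_conj_adjoint_QkW_le [FiniteDimensional ℂ W] (g : BondL2K ℂ d m c₁ W) :
    ‖(S ∘ₗ LinearMap.adjoint (QkW L m n φ U hL α hα1 hU1 hreg (c₀ := c₀) (c₁ := c₁)) ∘ₗ SFinv) g -
        (S ∘ₗ LinearMap.adjoint (QkW L m n φ V hL α' hα1' hV1 hregV (c₀ := c₀) (c₁ := c₁)) ∘ₗ SFinv) g‖ ≤
      Mφ' * Mφ * Real.sqrt (c₁ / (c₀ * ((L : ℝ) ^ (n + 1)) ^ d)) *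
        ((∏ j ∈ Finset.range (n + 1), (1 + Real.sqrt ((L : ℝ) ^ d) * (Real.sqrt (2 * d) * (102 * (d + 1) ^ 2 * L * εU j) +
            2 * (‖κc‖ * ℓ' j) * Real.sqrt (2 * (2 * d * (102 * (d + 1) ^ 2 * L * εU j) ^ 2 + ((L : ℝ) ^ d)⁻¹))))) *
          ((∏ j ∈ Finset.range (n + 1), (1 + Real.sqrt ((L : ℝ) ^ d) *
              ((1 + 2 * (‖κc‖ * ℓ' j)) * (2 * d) * (75497472 * ((d : ℝ) + 1) * ((2 * (d * L) + L + L : ℕ) : ℝ) * δUV j)))) - 1)) * ‖g‖ := by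
  have hc₀ : 0 < c₀ := Fact.out
  have hc₁ : 0 < c₁ := Fact.out
  have hP0 := prod_mul_prod_sub_one_nonneg (d := d) L n εU hεU δUV hδUV ℓ' hℓ' (κc := κc)
  refine B9Eq324ConjugatedFormDifference.norm_le_of_inner_eq_inner (𝕜 := ℂ)
    (K := fun g => (S ∘ₗ LinearMap.adjoint (QkW L m n φ U hL α hα1 hU1 hreg (c₀ := c₀) (c₁ := c₁)) ∘ₗ SFinv) g -
      (S ∘ₗ LinearMap.adjoint (QkW L m n φ V hL α' hα1' hV1 hregV (c₀ := c₀) (c₁ := c₁)) ∘ₗ SFinv) g)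
    (L := fun f => LinearMap.adjoint SFinv (QkW L m n φ U hL α hα1 hU1 hreg (c₀ := c₀) (c₁ := c₁) (LinearMap.adjoint S f)) -
      LinearMap.adjoint SFinv (QkW L m n φ V hL α' hα1' hV1 hregV (c₀ := c₀) (c₁ := c₁) (LinearMap.adjoint S f)))
    (mul_nonneg (by positivity) hP0) (fun e z => ?_)
    (fun f => norm_conj_QkW_sub_conj_QkW_le_negConj L m n hL φ hMφ hMφ' hφ hφ' U V α hα1 hU1 hreg α' hα1' hV1 hregV hα128 εU hεU hUε hVε δUV hδUV
      hδmax hUVδ χ ℓ' hℓ' hχ hwin hS hSFinv f) g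
  simp only [LinearMap.comp_apply, inner_sub_left, inner_sub_right, LinearMap.adjoint_inner_left, ← LinearMap.adjoint_inner_right S,
    ← LinearMap.adjoint_inner_right SFinv]

end Readings

end Literature.MathematicalPhysics.QuantumFieldTheory.Balaban1983to89.B9Eq349ConjugatedQTowerLettersTwoBackgroundsReadings

end
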